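import Literature.Computability.QuantumComplexity.RevUncomputeUniform
import HarnessLib

/-!
# Generators printing the multiplexer gadgets

Trunk `CryptoQuantFine`; uniformity companions of the gadgets of `RevMultiplex.lean` (the
one-hot length flags `RevMux.flagOps`, the flag-controlled router `RevMux.muxOps`, swap layers
`RevMux.swapOps` over a range of pairs), in the generator language of `GenPrograms.lean` /
`RevTableauUniform.lean` (`opsG`: the Clifford+T tokens of `NOT`/`CNOT`/Toffoli gates whose wires
are counter expressions). Each generator takes the wire maps as *expression transformers*
(`GE → GE`, resp. `GE → GE → GE`) that commute with evaluation through functions of the family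
index `u = env uu` (hypotheses `hemp`, `hflag`, … in the `out_*` lemmas), loops over `jj` (and `tt` for the router;
`ii` is the tick counter of `opsG`), and prints exactly the program tokens of the gadget
(`out_flagsG`, `out_routeG`, `out_swapsG`, stated with the gadgets' defining lists so that this
file does not depend on `RevMultiplex.lean`), with the loop-variable hygiene needed by
`GStmt.render_out_mem_FP` (`uu ∉ loopVars`, `noReuse`). (Arora–Barak 2009, §6.2 and proof of
Thm. 6.15: descriptions written with counters.)

## References

* S. Arora, B. Barak, *Computational Complexity: A Modern Approach*, CUP 2009, §6.2, proof of
  Thm. 6.15, Remark 6.7.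
* M. A. Nielsen, I. L. Chuang, *Quantum Computation and Quantum Information*, CUP 2010, §1.3.4,
  §3.2.5.
-/

noncomputable section

namespace Literature.Computability.QuantumComplexity

namespace RevMuxGen

open _root_.Computability Complexity RevDesc RevSim RevClean

/-! ### The flags -/

/-- **Generator of the flag program** `RevMux.flagOps emp flag L`. [cite: AroraBarak2009, §6.2 (descriptions printed with counters)] -/
def flagsG (empE flagE : GE → GE) (LE : GE) : GS :=
  GStmt.seq (opsG [ClOp.cnot (empE (.const 0)) (flagE (.const 0))])
    (GStmt.loop .jj LE (opsG [ClOp.not (empE (.var .jj)),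
      ClOp.toffoli (empE (.add (.var .jj) (.const 1))) (empE (.var .jj)) (flagE (.add (.var .jj) (.const 1))),
      ClOp.not (empE (.var .jj))]))

/-- **The flag generator prints the flag program.** [folklore] -/
theorem out_flagsG {empE flagE : GE → GE} {emp flag : ℕ → ℕ → ℕ}
    (hemp : ∀ a env, (empE a).eval env = emp (env .uu) (a.eval env))
    (hflag : ∀ a env, (flagE a).eval env = flag (env .uu) (a.eval env)) (LE : GE) (env : GV → ℕ) :
    (flagsG empE flagE LE).out env =
      (ClOp.cnot (emp (env .uu) 0) (flag (env .uu) 0) :: (List.range (LE.eval env)).flatMap fun ℓ =>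
        [ClOp.not (emp (env .uu) ℓ), ClOp.toffoli (emp (env .uu) (ℓ + 1)) (emp (env .uu) ℓ) (flag (env .uu) (ℓ + 1)),
          ClOp.not (emp (env .uu) ℓ)]).flatMap opToks := by
  have huj : ∀ k, Function.update env GV.jj k GV.uu = env GV.uu := fun k => Function.update_of_ne (by decide) _ _
  simp only [flagsG, GStmt.out, out_opsG, List.map_cons, List.map_nil, ClOp.map, hemp, hflag, GExpr.eval,
    Function.update_self, huj, List.flatMap_cons, List.flatMap_assoc, List.flatMap_nil, List.append_nil]

/-- Loop variables of the flag generator. [folklore] -/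
theorem loopVars_flagsG (empE flagE : GE → GE) (LE : GE) : ∀ x ∈ (flagsG empE flagE LE).loopVars, x = GV.jj ∨ x = GV.ii := by
  intro x hx
  simp only [flagsG, GStmt.loopVars, List.mem_append, List.mem_cons] at hx
  rcases hx with hx | rfl | hx
  · exact Or.inr (loopVars_opsG_sub _ x hx)
  · exact Or.inl rfl
  · exact Or.inr (loopVars_opsG_sub _ x hx)

/-- Non-reuse of the flag generator. [folklore] -/
theorem noReuse_flagsG (empE flagE : GE → GE) (LE : GE) : (flagsG empE flagE LE).noReuse = true :=
  noReuse_seq_of (noReuse_opsG _) (noReuse_loop_of (lv_opsG (by decide) _) (noReuse_opsG _))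

/-! ### The router -/

/-- **Generator of the router** `RevMux.muxOps flag src dst (fun ℓ => ℓ) L` (chunk `ℓ ≤ L`
copies `src i`, `i < ℓ`, into `dst ℓ i` under flag `ℓ`). [cite: AroraBarak2009, §6.2 (descriptions printed with counters)] -/
def routeG (flagE srcE : GE → GE) (dstE : GE → GE → GE) (LE : GE) : GS :=
  GStmt.loop .tt (.add LE (.const 1))
    (GStmt.loop .jj (.var .tt) (opsG [ClOp.toffoli (flagE (.var .tt)) (srcE (.var .jj)) (dstE (.var .tt) (.var .jj))]))

/-- **The router generator prints the router.** [folklore] -/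
theorem out_routeG {flagE srcE : GE → GE} {dstE : GE → GE → GE} {flag src : ℕ → ℕ → ℕ} {dst : ℕ → ℕ → ℕ → ℕ}
    (hflag : ∀ a env, (flagE a).eval env = flag (env .uu) (a.eval env))
    (hsrc : ∀ a env, (srcE a).eval env = src (env .uu) (a.eval env))
    (hdst : ∀ a b env, (dstE a b).eval env = dst (env .uu) (a.eval env) (b.eval env))
    (LE : GE) (env : GV → ℕ) :
    (routeG flagE srcE dstE LE).out env =
      ((List.range (LE.eval env + 1)).flatMap fun ℓ => (List.range ℓ).map fun i =>
        ClOp.toffoli (flag (env .uu) ℓ) (src (env .uu) i) (dst (env .uu) ℓ i)).flatMap opToks := by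
  have hut : ∀ k, Function.update env GV.tt k GV.uu = env GV.uu := fun k => Function.update_of_ne (by decide) _ _
  have hutj : ∀ k k', Function.update (Function.update env GV.tt k) GV.jj k' GV.uu = env GV.uu := fun k k' => by
    rw [Function.update_of_ne (by decide), hut]
  have hutt : ∀ k k', Function.update (Function.update env GV.tt k) GV.jj k' GV.tt = k := fun k k' => by
    rw [Function.update_of_ne (by decide), Function.update_self]
  simp only [routeG, GStmt.out, out_opsG, List.map_cons, List.map_nil, ClOp.map, hflag, hsrc, hdst, GExpr.eval,
    Function.update_self, hutj, hutt, List.flatMap_cons, List.flatMap_nil, List.append_nil,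
    List.flatMap_assoc, List.flatMap_map]

/-- Loop variables of the router generator. [folklore] -/
theorem loopVars_routeG (flagE srcE : GE → GE) (dstE : GE → GE → GE) (LE : GE) :
    ∀ x ∈ (routeG flagE srcE dstE LE).loopVars, x = GV.tt ∨ x = GV.jj ∨ x = GV.ii := by
  intro x hx
  simp only [routeG, GStmt.loopVars, List.mem_cons] at hx
  rcases hx with rfl | rfl | hx
  · exact Or.inl rfl
  · exact Or.inr (Or.inl rfl)
  · exact Or.inr (Or.inr (loopVars_opsG_sub _ x hx))

/-- Non-reuse of the router generator. [folklore] -/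
theorem noReuse_routeG (flagE srcE : GE → GE) (dstE : GE → GE → GE) (LE : GE) : (routeG flagE srcE dstE LE).noReuse = true :=
  noReuse_loop_of (fun x hx => by
      simp only [GStmt.loopVars, List.mem_cons] at hx
      rcases hx with rfl | hx
      · decide
      · rw [loopVars_opsG_sub _ x hx]; decide)
    (noReuse_loop_of (lv_opsG (by decide) _) (noReuse_opsG _))

/-! ### Swap layers over a range of pairs -/

/-- **Generator of the swap layer** `RevMux.swapOps ((List.range K).map fun j => (a j, b j))`.
[cite: NielsenChuang2010, §1.3.4 (swap from three CNOTs)] -/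
def swapsG (aE bE : GE → GE) (KE : GE) : GS :=
  GStmt.loop .jj KE (opsG [ClOp.cnot (aE (.var .jj)) (bE (.var .jj)), ClOp.cnot (bE (.var .jj)) (aE (.var .jj)),
    ClOp.cnot (aE (.var .jj)) (bE (.var .jj))])

/-- **The swap generator prints the swap layer.** [folklore] -/
theorem out_swapsG {aE bE : GE → GE} {a b : ℕ → ℕ → ℕ}
    (ha : ∀ c env, (aE c).eval env = a (env .uu) (c.eval env)) (hb : ∀ c env, (bE c).eval env = b (env .uu) (c.eval env))
    (KE : GE) (env : GV → ℕ) :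
    (swapsG aE bE KE).out env =
      ((List.range (KE.eval env)).flatMap fun j =>
        [ClOp.cnot (a (env .uu) j) (b (env .uu) j), ClOp.cnot (b (env .uu) j) (a (env .uu) j),
          ClOp.cnot (a (env .uu) j) (b (env .uu) j)]).flatMap opToks := by
  have huj : ∀ k, Function.update env GV.jj k GV.uu = env GV.uu := fun k => Function.update_of_ne (by decide) _ _
  simp only [swapsG, GStmt.out, out_opsG, List.map_cons, List.map_nil, ClOp.map, ha, hb, GExpr.eval,
    Function.update_self, huj, List.flatMap_assoc]

/-- Loop variables of the swap generator. [folklore] -/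
theorem loopVars_swapsG (aE bE : GE → GE) (KE : GE) : ∀ x ∈ (swapsG aE bE KE).loopVars, x = GV.jj ∨ x = GV.ii := by
  intro x hx
  simp only [swapsG, GStmt.loopVars, List.mem_cons] at hx
  rcases hx with rfl | hx
  · exact Or.inl rfl
  · exact Or.inr (loopVars_opsG_sub _ x hx)

/-- Non-reuse of the swap generator. [folklore] -/
theorem noReuse_swapsG (aE bE : GE → GE) (KE : GE) : (swapsG aE bE KE).noReuse = true :=
  noReuse_loop_of (lv_opsG (by decide) _) (noReuse_opsG _)

end RevMuxGen

end Literature.Computability.QuantumComplexity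

end
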